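import Summits.ResolutionOfSingularities.ResolutionOfSingularities.Theorems.FrobeniusLadderFRationalResolutionStratumDescent
import HarnessLib

/-!
# Crux `FrobeniusLadder.FRationalResolution` (stmt-ResolutionOfSingularities-15317), line `redirect`,
# stub `stub_diagonalizableQuotientResolution` — step (e-asm), prime level: regularity of the
# stratum `(L/(x_I)L)_𝔓̄` DESCENDS to the degree-zero side `(R₀/J)_{𝔓̄ ∩ R₀}` for any model `R₀` of
# the degree-zero localization (memo MEMO-15317-leafhand2-g3 §6–§7)

Continuation of `…StratumDescent` (flatness of `L/(x_I)L` over the degree-zero quotient). To avoid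
the instance diamonds on the grade-zero subtype `↥(locPiece … 0)` (typeclass search cannot build
`Module (↥(𝒮 0) ⧸ _) _` or ring homomorphisms out of its quotients), the degree-zero ring is an
ABSTRACT `R₀` with `[Algebra (𝒮 0) R₀] [IsLocalization.Away e R₀] [Algebra R₀ L]` commuting with
`S₀ → S → L` (take `R₀ = Localization.Away e` with the lifted algebra, or any model): then
`R₀ → L` maps onto `L₀`, `…GradedQuotientFree.flat_quotient` makes `L/(x_I)L` flat over
`R₀/((x_I)L ∩ R₀)`, and `…FlatPrimeDescent.isRegularLocalRing_atPrime_of_flat` descends regularity.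

* `algebraMap_mem_locPiece_zero`, `exists_eq_algebraMap_of_mem_locPiece_zero` — `R₀ → L` has image `L₀`;
* **`isRegularLocalRing_quotient_atPrime_of_stratum`** — for a prime `𝔓 ⊇ (x_I)L` of `L` with
  `(L/(x_I)L)_{𝔓̄}` regular: `(R₀/J)_{q₀/J}` is a regular local ring, `J = (x_I)L ∩ R₀`, `q₀ = 𝔓 ∩ R₀`.

Honest label: assembly brick (no stub closed; remaining: transport `R₀ = (S₀)_e ⇝ (S₀)_𝔮'` and
`J ⇝` Kato's ideal via `…FixedPointContraction`, then (f) and the `IsLogRegularAt` packaging).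
No definitions, no named facts, no sorry. [cite: Matsumura1987, Thm. 23.7 (i)]
[folklore; cite: Kato1994, Prop. (7.1)]
-/

noncomputable section

-- single-problem summit: the doubled namespace component is forced
set_option linter.dupNamespace false

open DirectSum Literature.RingTheory.GradedAlgebra
open Literature.AlgebraicGeometry.Resolution.DiagonalizableQuotient

namespace Summit.ResolutionOfSingularities.ResolutionOfSingularities.Theorems.FRationalResolution.StratumDescentPrime

universe u w

variable {k : Type u} [Field k] {A : Type w} [DecidableEq A] [AddCommGroup A] {S : Type u}
  [CommRing S] [Algebra k S] (𝒮 : A → Submodule k S) [GradedAlgebra 𝒮]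
  {n : ℕ} (x : Fin n → S) (a : Fin n → A) (hx : ∀ i, x i ∈ 𝒮 (a i))
  (e : 𝒮 0)
  (L : Type u) [CommRing L] [Algebra S L] [Algebra k L] [IsScalarTower k S L]
  [IsLocalization (Submonoid.powers (e : S)) L]
  (R₀ : Type u) [CommRing R₀] [Algebra (𝒮 0) R₀] [IsLocalization.Away e R₀] [Algebra R₀ L]
  (hcomm : ∀ c : 𝒮 0, algebraMap R₀ L (algebraMap (𝒮 0) R₀ c) = algebraMap S L (c : S))

omit [IsLocalization (Submonoid.powers (e : S)) L] in
include hcomm in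
/-- The model `R₀ = (S₀)_e` maps into the degree-zero piece `L₀` of `L = S_e`. [folklore] -/
theorem algebraMap_mem_locPiece_zero (r : R₀) :
    algebraMap R₀ L r ∈ locPiece 𝒮 (Submonoid.powers (e : S))
      (StratumDescent.powers_le_gradeZero 𝒮 e) L 0 := by
  obtain ⟨⟨c, s⟩, rfl⟩ := IsLocalization.mk'_surjective (Submonoid.powers e) r
  obtain ⟨m, hm⟩ := (Submonoid.mem_powers_iff _ _).mp s.2
  refine (mem_locPiece_iff _).mpr ⟨(e : S) ^ m, ⟨m, rfl⟩, c, c.2, ?_⟩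
  have hspec := IsLocalization.mk'_spec R₀ c s
  have h := congrArg (algebraMap R₀ L) hspec
  rw [map_mul, hcomm, hcomm] at h
  have hs : ((s : 𝒮 0) : S) = (e : S) ^ m := by
    rw [← hm, SetLike.GradeZero.coe_pow]
  rw [hs, mul_comm] at h
  exact h

include hcomm in
/-- … and ONTO it. [folklore] -/
theorem exists_eq_algebraMap_of_mem_locPiece_zero {y : L}
    (hy : y ∈ locPiece 𝒮 (Submonoid.powers (e : S)) (StratumDescent.powers_le_gradeZero 𝒮 e) L 0) :
    ∃ r : R₀, algebraMap R₀ L r = y := by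
  obtain ⟨t, ht, c, hc, hty⟩ := (mem_locPiece_iff _).mp hy
  obtain ⟨m, hm⟩ := (Submonoid.mem_powers_iff _ _).mp ht
  let s : Submonoid.powers e := ⟨e ^ m, Submonoid.pow_mem _ (Submonoid.mem_powers e) m⟩
  refine ⟨IsLocalization.mk' R₀ (⟨c, hc⟩ : 𝒮 0) s, ?_⟩
  have hspec := IsLocalization.mk'_spec R₀ (⟨c, hc⟩ : 𝒮 0) s
  have h := congrArg (algebraMap R₀ L) hspec
  rw [map_mul, hcomm, hcomm] at h
  have hs : ((s : 𝒮 0) : S) = t := by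
    rw [← hm]; exact SetLike.GradeZero.coe_pow e m
  rw [hs] at h
  -- `z * t = c = t * y` with `t` a unit
  have hunit : IsUnit (algebraMap S L t) := IsLocalization.map_units L ⟨t, ht⟩
  change algebraMap R₀ L _ * algebraMap S L t = algebraMap S L c at h
  rw [← hty, mul_comm (algebraMap S L t) y] at h
  exact hunit.mul_left_injective h

include hx hcomm in
/-- **Regularity of the stratum descends to the degree-zero model, prime by prime.** `S` Noetherian
of finite type, `x` homogeneous, `I ⊆ {1..n}`, `g • S ⊆ S₀[x]`, `g ∣ e`, `x_j ∣ e` (`j ∉ I`);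
`R₀` a Noetherian model of `(S₀)_e` mapping to `L = S_e` compatibly. For a prime `𝔓 ⊇ (x_I)L` of
`L` with `(L/(x_I)L)_{𝔓̄}` regular, the local ring of `R₀/J`, `J = (x_I)L ∩ R₀`, at `(𝔓 ∩ R₀)/J` is
regular. [cite: Matsumura1987, Thm. 23.7 (i)] [folklore; cite: Kato1994, Prop. (7.1)] -/
theorem isRegularLocalRing_quotient_atPrime_of_stratum [IsNoetherianRing R₀]
    (I : Finset (Fin n)) (g : 𝒮 0)
    (hgen : ∀ s : S, (g : S) * s ∈ Algebra.adjoin (𝒮 0) (Set.range x))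
    (hge : (g : S) ∣ (e : S)) (hxe : ∀ j ∉ I, x j ∣ (e : S))
    (𝔓 : Ideal L) [𝔓.IsPrime] (hI𝔓 : (Ideal.span (x '' (↑I : Set (Fin n)))).map (algebraMap S L) ≤ 𝔓)
    (hreg : haveI : (𝔓.map (Ideal.Quotient.mk
        ((Ideal.span (x '' (↑I : Set (Fin n)))).map (algebraMap S L)))).IsPrime :=
        Ideal.isPrime_map_quotientMk_of_isPrime hI𝔓
      IsRegularLocalRing (Localization.AtPrime (𝔓.map (Ideal.Quotient.mk
        ((Ideal.span (x '' (↑I : Set (Fin n)))).map (algebraMap S L)))))) :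
    haveI : ((𝔓.comap (algebraMap R₀ L)).map (Ideal.Quotient.mk
        (((Ideal.span (x '' (↑I : Set (Fin n)))).map (algebraMap S L)).comap (algebraMap R₀ L)))).IsPrime :=
      Ideal.isPrime_map_quotientMk_of_isPrime (Ideal.comap_mono hI𝔓)
    IsRegularLocalRing (Localization.AtPrime ((𝔓.comap (algebraMap R₀ L)).map (Ideal.Quotient.mk
        (((Ideal.span (x '' (↑I : Set (Fin n)))).map (algebraMap S L)).comap (algebraMap R₀ L))))) := by
  classical
  set T : Submonoid S := Submonoid.powers (e : S) with hTdef
  have hT : ∀ t ∈ T, t ∈ 𝒮 0 := StratumDescent.powers_le_gradeZero 𝒮 e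
  let ℒ := locPiece 𝒮 T hT L
  letI : GradedAlgebra ℒ := (nonempty_gradedAlgebra_locPiece 𝒮 T hT L).some
  set IS : Ideal S := Ideal.span (x '' (↑I : Set (Fin n))) with hIS
  set IL : Ideal L := IS.map (algebraMap S L) with hIL
  set J : Ideal R₀ := IL.comap (algebraMap R₀ L) with hJ
  set q₀ : Ideal R₀ := 𝔓.comap (algebraMap R₀ L) with hq₀
  -- homogeneity of `IL`
  have hIhom : IL.IsHomogeneous ℒ := by
    have h : IL = Ideal.span (algebraMap S L '' (x '' (↑I : Set (Fin n)))) := by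
      rw [hIL, hIS, Ideal.map_span]
    rw [h]
    refine Ideal.homogeneous_span ℒ _ ?_
    rintro _ ⟨_, ⟨i, -, rfl⟩, rfl⟩
    exact ⟨a i, algebraMap_mem_locPiece hT (hx i)⟩
  -- units
  have heunit : IsUnit (algebraMap S L (e : S)) := IsLocalization.Away.algebraMap_isUnit (e : S)
  have hgunit : IsUnit (algebraMap S L (g : S)) :=
    isUnit_of_dvd_unit (map_dvd (algebraMap S L) hge) heunit
  have hxunit : ∀ j ∉ I, IsUnit (algebraMap S L (x j)) := fun j hj =>
    isUnit_of_dvd_unit (map_dvd (algebraMap S L) (hxe j hj)) heunit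
  -- support degrees
  let D : Set A := {c | ∃ m : Fin n → ℕ, (∀ i ∈ I, m i = 0) ∧ ∑ i, m i • a i = c}
  have hD : ∀ c ∈ D, ∃ m : Fin n → ℕ, (∀ i ∈ I, m i = 0) ∧ ∑ i, m i • a i = c := fun c hc => hc
  choose m hmI hmdeg using hD
  let u : A → L := fun c => if hc : c ∈ D then algebraMap S L (∏ i, x i ^ m c hc i) else 0
  have hu : ∀ c ∈ D, u c ∈ ℒ c := by
    intro c hc
    simp only [u, dif_pos hc]
    have h := SetLike.prod_pow_mem_graded 𝒮 (F := Finset.univ) (i := a) (g := x) (m c hc)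
      fun i _ => hx i
    rw [hmdeg c hc] at h
    exact algebraMap_mem_locPiece hT h
  have hunit : ∀ c ∈ D, IsUnit (u c) := by
    intro c hc
    simp only [u, dif_pos hc, map_prod, map_pow]
    refine IsUnit.prod_univ_iff.mpr fun i => ?_
    by_cases hi : i ∈ I
    · rw [hmI c hc i hi, pow_zero]; exact isUnit_one
    · exact (hxunit i hi).pow _
  have hzero : ∀ c ∉ D, (ℒ c : Set L) ⊆ IL := by
    intro c hc y hy
    obtain ⟨t, ht, s, hs, hty⟩ := (mem_locPiece_iff hT).mp hy
    have hgs : (g : S) * s ∈ IS :=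
      OffSupportDegrees.mul_mem_span_of_degree_not_mem 𝒮 x a hx I g hgen c hc s hs
    have hgsL : algebraMap S L ((g : S) * s) ∈ IL := Ideal.mem_map_of_mem _ hgs
    obtain ⟨w, hw⟩ := (hgunit.mul (IsLocalization.map_units L ⟨t, ht⟩)).exists_left_inv
    have hy' : y = w * algebraMap S L ((g : S) * s) := by
      calc y = w * (algebraMap S L (g : S) * algebraMap S L t) * y := by
              rw [show algebraMap S L (↑(⟨t, ht⟩ : T)) = algebraMap S L t from rfl] at hw
              rw [hw, one_mul]
        _ = w * algebraMap S L ((g : S) * s) := by rw [map_mul, ← hty]; ring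
    rw [SetLike.mem_coe, hy']
    exact IL.mul_mem_left w hgsL
  -- `R₀` models `ℒ 0`
  have h0 : ∀ r : R₀, algebraMap R₀ L r ∈ ℒ 0 := fun r =>
    algebraMap_mem_locPiece_zero 𝒮 e L R₀ hcomm r
  have hsurj : ∀ s ∈ ℒ 0, ∃ r : R₀, algebraMap R₀ L r = s := fun s hs =>
    exists_eq_algebraMap_of_mem_locPiece_zero 𝒮 e L R₀ hcomm hs
  haveI hflat : Module.Flat (R₀ ⧸ J) (L ⧸ IL) :=
    GradedQuotientFree.flat_quotient ℒ h0 hsurj IL hIhom D u hu hunit hzero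
  -- primes and descent
  haveI hq' : (𝔓.map (Ideal.Quotient.mk IL)).IsPrime := Ideal.isPrime_map_quotientMk_of_isPrime hI𝔓
  have hJq₀ : J ≤ q₀ := Ideal.comap_mono hI𝔓
  haveI hq₀' : (q₀.map (Ideal.Quotient.mk J)).IsPrime := Ideal.isPrime_map_quotientMk_of_isPrime hJq₀
  have hcomap : q₀.map (Ideal.Quotient.mk J) =
      (𝔓.map (Ideal.Quotient.mk IL)).comap (algebraMap (R₀ ⧸ J) (L ⧸ IL)) := by
    ext r
    obtain ⟨r, rfl⟩ := Ideal.Quotient.mk_surjective r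
    rw [Ideal.mem_comap, Ideal.mem_quotient_iff_mem hJq₀,
      show algebraMap (R₀ ⧸ J) (L ⧸ IL) (Ideal.Quotient.mk J r) =
        Ideal.Quotient.mk IL (algebraMap R₀ L r) from rfl,
      Ideal.mem_quotient_iff_mem hI𝔓, hq₀, Ideal.mem_comap]
  haveI : IsRegularLocalRing (Localization.AtPrime (𝔓.map (Ideal.Quotient.mk IL))) := hreg
  exact FlatPrimeDescent.isRegularLocalRing_atPrime_of_flat (B := R₀ ⧸ J) (B' := L ⧸ IL)
    (𝔓.map (Ideal.Quotient.mk IL)) (q₀.map (Ideal.Quotient.mk J)) hcomap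

end Summit.ResolutionOfSingularities.ResolutionOfSingularities.Theorems.FRationalResolution.StratumDescentPrime

end
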